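import Literature.Analysis.FluidPDE.PeriodicCylinderHelmholtz
import Literature.Analysis.FluidPDE.PeriodicCylinderWithinCalculus
import Literature.Analysis.FluidPDE.Ferrari1993PressureNeumannProblem
import HarnessLib

/-!
# The convective derivative within the closed cylinder: smoothness, the wall identity and the
# divergence identity

Analysis/FluidPDE support file for the energy-method construction of Euler flows in the
periodic cylinder (`Literature.Analysis.FluidPDE.KatoLai1984_periodicCylinderUniformExistence`;
Kato–Lai 1984, §4 (4.1) `F(u, v) = (u·∇)v` and the pressure estimate (4.4), whose proof for a
bounded domain — Temam 1975 — rests on the two pieces of calculus recorded here). For a field `w`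
smooth on the closed cylinder `{r ≤ 1}` the convective derivative within,
`(w·∇_K)f (x) = D_K f(x)[w(x)]` (`PeriodicCylinder.cylDeriv w f`), satisfies:

* `cylDeriv_eq_sum_coord_smul`, `contDiffOn_cylDeriv_field`, `isSmoothPeriodic_cylDeriv` —
  expansion in the coordinate derivations, smoothness on the closed cylinder and periodicity;
* `inner_cylDeriv_self_horizontalProj_of_wall` — **the wall identity**: if `w` is tangential on
  the wall then `⟪(w·∇_K)w, x_h⟫ = -|w_h|²` there (the Neumann datum of the pressure is the
  second fundamental form, no derivative of `w`);
* `cylDiv_cylDeriv_self` — **the divergence identity** on the closed cylinder: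
  `div_K ((w·∇_K)w) = ∑ᵢⱼ (∂ᵢw)ⱼ (∂ⱼw)ᵢ + (w·∇_K)(div_K w)`, and on the open cylinder for
  `div w = 0` there: `div ((w·∇_K)w) = ∑ᵢⱼ (∂ᵢw)ⱼ (∂ⱼw)ᵢ` (`divergence_cylDeriv_self_of_divFree`).

Everything is proved; no named fact and no `sorry` is introduced.

## Mathlib / tree search

Tree: `PeriodicCylinder.cylDeriv` and its rules (`cylDeriv_smul`, `cylDeriv_inner`,
`cylDeriv_finset_sum`, `cylDeriv_clm_comp`, `cylDeriv_const_comm`, `cylDeriv_field_add/smul`,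
`cylDeriv_eq_zero_of_wall_of_tangent`, `cylDiv`, `cylDiv_eq_divergence`, `cylDeriv_eq_fderiv`;
`eq_rotGen_add_axial_of_inner_eR_eq_zero` (`Ferrari1993PressureNeumannProblem`, the tangent decomposition at the wall);
`PeriodicCylinderWithinCalculus`), `eR_eq_horizontalProj_of_wall`, `frontier_unitCylinder`,
`IsSmoothPeriodic` (`PeriodicCylinderHelmholtz`).

## References

* T. Kato, C. Y. Lai, J. Funct. Anal. 56 (1984) 15–28, §4. [KatoLai1984]
* R. Temam, J. Funct. Anal. 20 (1975) 32–43, §1 (the pressure Neumann problem). [Temam1975]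
-/

noncomputable section

open MeasureTheory Set Function Filter Topology TopologicalSpace WithLp Metric Module
open scoped ContDiff NNReal ENNReal InnerProductSpace RealInnerProductSpace

namespace Literature.Analysis.FluidPDE

open Literature.Analysis.FunctionSpaces

/-- Local notation for physical space `ℝ³ = EuclideanSpace ℝ (Fin 3)`. -/
local notation "ℝ³" => EuclideanSpace ℝ (Fin 3)

/-- Local notation for the closed unit cylinder `{r ≤ 1}`. -/
local notation "𝕂" => closure (SetLike.coe unitCylinder : Set (EuclideanSpace ℝ (Fin 3)))

namespace PeriodicCylinder

variable {L : ℝ} {F : Type*} [NormedAddCommGroup F] [NormedSpace ℝ F]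

/-! ### Derivations along fields smooth on the closed cylinder -/

/-- **Expansion in the coordinate derivations**: `∂_V f (x) = ∑ᵢ Vᵢ(x) ∂ᵢ f (x)`. [folklore] -/
theorem cylDeriv_eq_sum_coord_smul (V : ℝ³ → ℝ³) (f : ℝ³ → F) (x : ℝ³) :
    cylDeriv V f x = ∑ i, V x i • cylDeriv (fun _ => cylBasis i) f x := by
  simp only [cylDeriv_apply]
  conv_lhs => rw [← sum_apply_smul_cylBasis (V x)]
  rw [map_sum]
  exact Finset.sum_congr rfl fun i _ => by rw [map_smul]

/-- Components of fields smooth on the closed cylinder are smooth there. [folklore] -/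
theorem contDiffOn_coord {V : ℝ³ → ℝ³} (hV : ContDiffOn ℝ ∞ V 𝕂) (i : Fin 3) :
    ContDiffOn ℝ ∞ (fun x => V x i) 𝕂 :=
  (contDiff_cylCoordFun i).comp_contDiffOn hV

/-- **Smoothness**: `∂_V f` is smooth on the closed cylinder when `V` and `f` are. [folklore] -/
theorem contDiffOn_cylDeriv_field {V : ℝ³ → ℝ³} (hV : ContDiffOn ℝ ∞ V 𝕂) {f : ℝ³ → F}
    (hf : ContDiffOn ℝ ∞ f 𝕂) : ContDiffOn ℝ ∞ (cylDeriv V f) 𝕂 := by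
  have h : cylDeriv V f = fun x => ∑ i, V x i • cylDeriv (fun _ => cylBasis i) f x :=
    funext (cylDeriv_eq_sum_coord_smul V f)
  rw [h]
  exact ContDiffOn.sum fun i _ => (contDiffOn_coord hV i).smul (contDiffOn_cylDeriv contDiff_const hf)

/-- **Periodicity and smoothness**: `∂_V f` is smooth periodic when `V` and `f` are. [folklore] -/
theorem isSmoothPeriodic_cylDeriv {V : ℝ³ → ℝ³} (hV : IsSmoothPeriodic L V) {f : ℝ³ → F}
    (hf : IsSmoothPeriodic L f) : IsSmoothPeriodic L (cylDeriv V f) :=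
  ⟨contDiffOn_cylDeriv_field hV.smooth hf.smooth, hf.periodic.cylDeriv hV.periodic⟩

/-- `∂_V` of a component is the component of `∂_V`. [folklore] -/
theorem cylDeriv_apply_coord {V : ℝ³ → ℝ³} {W : ℝ³ → ℝ³} (hW : ContDiffOn ℝ ∞ W 𝕂) (i : Fin 3) {x : ℝ³}
    (hx : x ∈ 𝕂) : cylDeriv V (fun y => W y i) x = (cylDeriv V W x) i := by
  have := cylDeriv_clm_comp (V := V) (EuclideanSpace.proj i : ℝ³ →L[ℝ] ℝ) hW hx
  exact this

/-! ### The wall identity -/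

/-- `⟪v, v_h⟫ = |v_h|²`. [folklore] -/
theorem inner_horizontalProj_self (v : ℝ³) : ⟪v, horizontalProj v⟫ = ‖horizontalProj v‖ ^ 2 := by
  have h0 : ⟪v - horizontalProj v, horizontalProj v⟫ = 0 := by
    simp [horizontalProj_apply_eq, EuclideanSpace.inner_eq_star_dotProduct, Fin.sum_univ_three, dotProduct,
      Matrix.vecHead, Matrix.vecTail]
  calc ⟪v, horizontalProj v⟫ = ⟪(v - horizontalProj v) + horizontalProj v, horizontalProj v⟫ := by rw [sub_add_cancel]
    _ = ‖horizontalProj v‖ ^ 2 := by rw [inner_add_left, h0, zero_add, real_inner_self_eq_norm_sq]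

/-- `∂_V x_h = V_h` on the closed cylinder. [folklore] -/
theorem cylDeriv_horizontalProj_fun (V : ℝ³ → ℝ³) {x : ℝ³} (hx : x ∈ 𝕂) :
    cylDeriv V (fun y => horizontalProj y) x = horizontalProj (V x) := by
  rw [cylDeriv_eq_fderiv_of_differentiableAt (contDiff_horizontalProj.differentiable (by simp)).differentiableAt hx,
    fderiv_horizontalProj]
  rfl

/-- **The wall identity**: for `w` smooth on the closed cylinder and tangential on the wall,
`⟪(w·∇_K)w, x_h⟫ = -|w_h|²` at every wall point (the function `⟪w, x_h⟫` vanishes on the wall and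
`w` is tangent to it, so `(w·∇_K)⟪w, x_h⟫ = 0`). [cite: Temam1975, §1] -/
theorem inner_cylDeriv_self_horizontalProj_of_wall {w : ℝ³ → ℝ³} (hw : ContDiffOn ℝ ∞ w 𝕂)
    (hslip : ∀ x ∈ frontier (unitCylinder : Set ℝ³), ⟪w x, eR x⟫ = 0) {x : ℝ³}
    (hx : x ∈ frontier (unitCylinder : Set ℝ³)) :
    ⟪cylDeriv w w x, horizontalProj x⟫ = -‖horizontalProj (w x)‖ ^ 2 := by
  have hxK : x ∈ 𝕂 := frontier_subset_K hx
  set φ : ℝ³ → ℝ := fun y => ⟪w y, horizontalProj y⟫ with hφ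
  have hφs : ContDiffOn ℝ ∞ φ 𝕂 := hw.inner ℝ contDiff_horizontalProj.contDiffOn
  -- `φ` vanishes on the wall
  have hφ0 : ∀ y ∈ frontier (unitCylinder : Set ℝ³), φ y = 0 := fun y hy => by
    rw [hφ]; dsimp only
    rw [← eR_eq_horizontalProj_of_wall hy]
    exact hslip y hy
  -- `w x` is tangent
  have htan := eq_rotGen_add_axial_of_inner_eR_eq_zero hx (hslip x hx)
  have hzero : cylDeriv w φ x = 0 := cylDeriv_eq_zero_of_wall_of_tangent hφs hφ0 hx htan
  -- Leibniz
  have hL : cylDeriv w φ x = ⟪cylDeriv w w x, horizontalProj x⟫ + ⟪w x, cylDeriv w (fun y => horizontalProj y) x⟫ :=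
    cylDeriv_inner hw contDiff_horizontalProj.contDiffOn hxK
  rw [hzero, cylDeriv_horizontalProj_fun w hxK, inner_horizontalProj_self] at hL
  linarith

/-! ### The divergence identity -/

/-- The trace of `(D_K w)²`: `∑ᵢⱼ (∂ᵢw)ⱼ (∂ⱼw)ᵢ`, smooth on the closed cylinder for smooth `w`. [folklore] -/
def gradSqTrace (w : ℝ³ → ℝ³) (x : ℝ³) : ℝ :=
  ∑ i, ∑ j, (cylDeriv (fun _ => cylBasis i) w x) j * (cylDeriv (fun _ => cylBasis j) w x) i

/-- `gradSqTrace w` is smooth on the closed cylinder. [folklore] -/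
theorem contDiffOn_gradSqTrace {w : ℝ³ → ℝ³} (hw : ContDiffOn ℝ ∞ w 𝕂) : ContDiffOn ℝ ∞ (gradSqTrace w) 𝕂 := by
  unfold gradSqTrace
  refine ContDiffOn.sum fun i _ => ContDiffOn.sum fun j _ => ?_
  exact (contDiffOn_coord (contDiffOn_cylDeriv contDiff_const hw) j).mul
    (contDiffOn_coord (contDiffOn_cylDeriv contDiff_const hw) i)

/-- `gradSqTrace w` is periodic when `w` is. [folklore] -/
theorem isAxiallyPeriodic_gradSqTrace {w : ℝ³ → ℝ³} (hw : IsAxiallyPeriodic L w) : IsAxiallyPeriodic L (gradSqTrace w) := by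
  intro x
  unfold gradSqTrace
  have h : ∀ i : Fin 3, cylDeriv (fun _ => cylBasis i) w (x + L • EuclideanSpace.single 2 1) = cylDeriv (fun _ => cylBasis i) w x :=
    fun i => (hw.cylDeriv (V := fun _ => cylBasis i) fun _ => rfl) x
  simp only [h]

/-- **The divergence identity within the closed cylinder**:
`div_K ((w·∇_K)w) = ∑ᵢⱼ (∂ᵢw)ⱼ (∂ⱼw)ᵢ + (w·∇_K)(div_K w)`. [folklore] -/
theorem cylDiv_cylDeriv_self {w : ℝ³ → ℝ³} (hw : ContDiffOn ℝ ∞ w 𝕂) {x : ℝ³} (hx : x ∈ 𝕂) :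
    cylDiv (cylDeriv w w) x = gradSqTrace w x + cylDeriv w (cylDiv w) x := by
  have hDw : ∀ j, ContDiffOn ℝ ∞ (cylDeriv (fun _ => cylBasis j) w) 𝕂 := fun j => contDiffOn_cylDeriv contDiff_const hw
  have hwj : ∀ j, ContDiffOn ℝ ∞ (fun y => w y j) 𝕂 := fun j => contDiffOn_coord hw j
  -- expand `(w·∇)w = ∑ⱼ wⱼ ∂ⱼ w`
  have hexp : cylDeriv w w = fun y => ∑ j, w y j • cylDeriv (fun _ => cylBasis j) w y :=
    funext (cylDeriv_eq_sum_coord_smul w w)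
  -- `∂ᵢ` of the expansion
  have hi : ∀ i, cylDeriv (fun _ => cylBasis i) (cylDeriv w w) x =
      ∑ j, ((cylDeriv (fun _ => cylBasis i) w x) j • cylDeriv (fun _ => cylBasis j) w x +
        w x j • cylDeriv (fun _ => cylBasis i) (cylDeriv (fun _ => cylBasis j) w) x) := by
    intro i
    rw [hexp, cylDeriv_finset_sum (f := fun j y => w y j • cylDeriv (fun _ => cylBasis j) w y) _
      (fun j _ => by exact (hwj j).smul (hDw j)) hx]
    refine Finset.sum_congr rfl fun j _ => ?_
    rw [cylDeriv_smul (hwj j) (hDw j) hx, cylDeriv_apply_coord hw j hx]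
  -- the divergence
  rw [cylDiv_apply]
  simp only [hi]
  -- split the two sums
  have hsplit : ∀ i, (∑ j, ((cylDeriv (fun _ => cylBasis i) w x) j • cylDeriv (fun _ => cylBasis j) w x +
      w x j • cylDeriv (fun _ => cylBasis i) (cylDeriv (fun _ => cylBasis j) w) x)) i =
      (∑ j, (cylDeriv (fun _ => cylBasis i) w x) j * (cylDeriv (fun _ => cylBasis j) w x) i) +
      ∑ j, w x j * (cylDeriv (fun _ => cylBasis i) (cylDeriv (fun _ => cylBasis j) w) x) i := by
    intro i
    rw [WithLp.ofLp_sum, Finset.sum_apply, ← Finset.sum_add_distrib]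
    refine Finset.sum_congr rfl fun j _ => ?_
    simp only [WithLp.ofLp_add, WithLp.ofLp_smul, Pi.add_apply, Pi.smul_apply, smul_eq_mul]
  simp only [hsplit]
  rw [Finset.sum_add_distrib]
  unfold gradSqTrace
  congr 1
  -- the second sum is `(w·∇)(div w)`: commute `∂ᵢ ∂ⱼ = ∂ⱼ ∂ᵢ` and pull out components
  rw [Finset.sum_comm, cylDeriv_eq_sum_coord_smul w (cylDiv w) x]
  refine Finset.sum_congr rfl fun j _ => ?_
  rw [← Finset.mul_sum, smul_eq_mul]
  congr 1
  -- `∑ᵢ (∂ᵢ∂ⱼ w)ᵢ = ∂ⱼ (∑ᵢ (∂ᵢ w)ᵢ)`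
  have hdiv : cylDiv w = fun y => ∑ i, (cylDeriv (fun _ => cylBasis i) w y) i := funext (cylDiv_apply w)
  rw [hdiv, cylDeriv_finset_sum (f := fun i y => (cylDeriv (fun _ => cylBasis i) w y) i) _
    (fun i _ => contDiffOn_coord (hDw i) i) hx]
  refine Finset.sum_congr rfl fun i _ => ?_
  rw [cylDeriv_const_comm (cylBasis i) (cylBasis j) hw hx, cylDeriv_apply_coord (hDw i) i hx]

/-- **The divergence identity on the open cylinder for a solenoidal field**: if `div w = 0` on
`{r < 1}` then `div ((w·∇_K)w) = ∑ᵢⱼ (∂ᵢw)ⱼ (∂ⱼw)ᵢ` there. [cite: Temam1975, §1] -/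
theorem divergence_cylDeriv_self_of_divFree {w : ℝ³ → ℝ³} (hw : ContDiffOn ℝ ∞ w 𝕂)
    (hdiv : ∀ x ∈ (unitCylinder : Set ℝ³), VectorCalculus.divergence w x = 0) {x : ℝ³}
    (hx : x ∈ (unitCylinder : Set ℝ³)) :
    VectorCalculus.divergence (cylDeriv w w) x = gradSqTrace w x := by
  have hxK : x ∈ 𝕂 := subset_closure hx
  rw [← cylDiv_eq_divergence _ hx, cylDiv_cylDeriv_self hw hxK]
  -- `div_K w = 0` near `x`, so its derivative within vanishes
  have hzero : cylDiv w =ᶠ[𝓝 x] fun _ => (0 : ℝ) := by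
    filter_upwards [unitCylinder.isOpen.mem_nhds hx] with y hy
    rw [cylDiv_eq_divergence _ hy, hdiv y hy]
  have hd : cylDeriv w (cylDiv w) x = 0 := by
    rw [cylDeriv_eq_fderiv _ _ hx, hzero.fderiv_eq]
    simp
  rw [hd, add_zero]

end PeriodicCylinder

end Literature.Analysis.FluidPDE
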